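import Literature.MathematicalPhysics.QuantumLattice.ShiftedHubbardDysonDeterminant
import Literature.MathematicalPhysics.QuantumLattice.HubbardDysonDeterminant
import HarnessLib

/-!
# The renormalised perturbation series of the Hubbard two-point function, coefficients as shifted determinants

Topic `MathematicalPhysics/QuantumLattice`; the two-point companion of `ShiftedHubbardDysonDeterminant` (partition
function with the Hartree / chemical-potential counterterm `ν` on the diagonal of every fermionic determinant,
BGM 2006 §2) and the shifted companion of `HubbardDysonDeterminant.hasSum_hubbard_twoPoint_det` (equal-time
two-point function without counterterm).  For the Hubbard model with SHIFTED densities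
`H = dΓ(h_μ) + U Σ_x (n_{x↑} − ν₀)(n_{x↓} − ν₁)` and the observable `c†_{xσ} c_{yσ'}`:

* `gibbsState_dGamma_twoPoint_mul_prod_shiftedHubbardVertex_eq_det` — the free expectation of
  `c†_{xσ}c_{yσ'} ∏ᵢ (n_{xᵢ↑}(sᵢ) − ν₀)(n_{xᵢ↓}(sᵢ) − ν₁)` is `det (propMatrix − diagonal (0, ν, ν, …))` on the `2k+1` pairs
  of `hubbardWordOrb/Time` (pair `0` = the observable, unshifted; `ShiftedWickDeterminant` with pair-dependent shifts);
* `hasSum_shiftedHubbard_twoPoint_det` — `Tr(e^{−βH} c†_{xσ}c_{yσ'}) = Σ_k U^k (−β)^k ∫ Σ_{x⃗} Z₀ det(G_{2k+1} − D) du`;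
* **`hasSum_hubbard_twoPoint_renormalised_det`** — for equal real shifts `ν`, with the FREE one-body matrix at `μ` and
  the interacting model at `μ + Uν`:
  `Σ_k U^k (−β)^k ∫_{0≤u₀≤⋯≤1} Σ_{x⃗} Z₀ det (G_{2k+1}(x⃗,u) − diag(0,ν,…,ν)) du
     = e^{−βUν²|Λ|} · Tr(e^{−β(H(t,U) − (μ+Uν)N)} c†_{xσ} c_{yσ'})`.

This is the Hamiltonian side of the two-point `M → ∞` bridge (the Grassmann side is `HubbardTwoPointMoments`,
`ν = ½`).

## References
* G. Benfatto, A. Giuliani, V. Mastropietro, Ann. Henri Poincaré 7 (2006) 809, §2 (determinant expansion with the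
  counterterm `ν`), §2.1 (2.8). [cite: BenfattoGiulianiMastropietro2006, §2.1 (2.8)]
* M. Gaudin, Nucl. Phys. 15 (1960) 89. [cite: Gaudin1960]
-/

noncomputable section

namespace Literature.MathematicalPhysics.QuantumLattice

open NormedSpace Matrix Finset
open scoped ComplexOrder

/-! ### The Dyson series of a shifted quartic perturbation with an observable -/

section ShiftedQuartic

variable {ι : Type*} [LinearOrder ι] [Fintype ι]

/-- **Dyson series of `Tr(e^{−β(H₀+gV)} O)` for a SHIFTED quartic perturbation** `V = Σ_r v_r (c†_{p₁r}c_{q₁r} − ν₁r)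
(c†_{p₂r}c_{q₂r} − ν₂r)` and any observable `O`: the coefficients are ordered imaginary-time integrals of
`Tr(e^{−βH₀} O ∏ᵢ (a⁺a⁻(sᵢ) − ν₁)(a⁺a⁻(sᵢ) − ν₂))`, `sᵢ = −βuᵢ` (conjugation by `e^{sH₀}` is multiplicative and fixes
the shifts). BGM 2006 §2.1 (2.8) with counterterms. [cite: BenfattoGiulianiMastropietro2006, §2.1 (2.8)] -/
theorem hasSum_dyson_trace_mul_shiftedQuartic {R : Type*} [Fintype R] (β : ℝ) (h : Matrix ι ι ℂ)
    (O : Matrix (Finset ι) (Finset ι) ℂ) (v : R → ℂ) (p₁ q₁ p₂ q₂ : R → ι) (ν₁ ν₂ : R → ℂ) (g : ℂ) :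
    HasSum (fun k : ℕ => g ^ k * orderedIntegral k
      (fun u : Fin k → ℝ =>
        (-(β : ℂ)) ^ k * ∑ f : Fin k → R, (∏ i, v (f i)) *
          (Matrix.gibbsWeight β (dGamma h) * (O *
            (List.ofFn fun i : Fin k =>
              ((exp ((((u i : ℝ) : ℂ) * -(β : ℂ)) • dGamma h) * creation (p₁ (f i)) * exp (-((((u i : ℝ) : ℂ) * -(β : ℂ)) • dGamma h))) * (exp ((((u i : ℝ) : ℂ) * -(β : ℂ)) • dGamma h) * annihilation (q₁ (f i)) * exp (-((((u i : ℝ) : ℂ) * -(β : ℂ)) • dGamma h))) -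
                  ν₁ (f i) • (1 : Matrix (Finset ι) (Finset ι) ℂ)) *
                ((exp ((((u i : ℝ) : ℂ) * -(β : ℂ)) • dGamma h) * creation (p₂ (f i)) * exp (-((((u i : ℝ) : ℂ) * -(β : ℂ)) • dGamma h))) * (exp ((((u i : ℝ) : ℂ) * -(β : ℂ)) • dGamma h) * annihilation (q₂ (f i)) * exp (-((((u i : ℝ) : ℂ) * -(β : ℂ)) • dGamma h))) -
                  ν₂ (f i) • (1 : Matrix (Finset ι) (Finset ι) ℂ))).prod)).trace) 1)
      ((Matrix.gibbsWeight β (dGamma h + g • ∑ r, v r •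
          ((creation (p₁ r) * annihilation (q₁ r) - ν₁ r • 1) *
            (creation (p₂ r) * annihilation (q₂ r) - ν₂ r • 1))) * O).trace) := by
  have hs := hasSum_dyson_trace_gibbsWeight_sum β (dGamma h) O v
    (fun r => (creation (p₁ r) * annihilation (q₁ r) - ν₁ r • 1) *
      (creation (p₂ r) * annihilation (q₂ r) - ν₂ r • 1)) g
  simp only [exp_mul_mul_mul_exp_neg, exp_mul_sub_smul_one_mul_exp_neg] at hs
  exact hs

end ShiftedQuartic

/-! ### The Hubbard two-point word with shifted densities: determinant coefficients -/

section ShiftedHubbard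

variable {Λ : Type*} [LinearOrder Λ] [Fintype Λ]

/-- **The free expectations in the shifted two-point Dyson coefficients are shifted determinants**: for a Hermitian
one-body matrix `h`, the observable `c†_{xσ}c_{yσ'}` (time `0`, unshifted) and vertices `xᵢ = f i` at times `sᵢ` with
shifts `ν₀, ν₁`,
`⟨c†_{xσ}c_{yσ'} ∏ᵢ (a⁺_{xᵢ↑}a⁻_{xᵢ↑}(sᵢ) − ν₀)(a⁺_{xᵢ↓}a⁻_{xᵢ↓}(sᵢ) − ν₁)⟩_{β,dΓ(h)} = det (G − D)`, `G` the `(2k+1)`-pair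
propagator matrix on `hubbardWordOrb/Time` and `D = diagonal (0, ν_{j(m)})` (`ShiftedWickDeterminant`).
[cite: BenfattoGiulianiMastropietro2006, §2.1 (2.8)] -/
theorem gibbsState_dGamma_twoPoint_mul_prod_shiftedHubbardVertex_eq_det {h : Matrix (Orb Λ) (Orb Λ) ℂ}
    (hh : h.IsHermitian) (β : ℝ) {k : ℕ} (x y : Λ) (σ σ' : Fin 2) (f : Fin k → Λ) (s : Fin k → ℂ)
    (ν : Fin 2 → ℂ) :
    gibbsState β (dGamma h) (creation (orb x σ) * annihilation (orb y σ') *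
        (List.ofFn fun i : Fin k =>
          ((exp (s i • dGamma h) * creation (orb (f i) 0) * exp (-(s i • dGamma h))) *
                (exp (s i • dGamma h) * annihilation (orb (f i) 0) * exp (-(s i • dGamma h))) -
              ν 0 • (1 : Matrix (Finset (Orb Λ)) (Finset (Orb Λ)) ℂ)) *
            ((exp (s i • dGamma h) * creation (orb (f i) 1) * exp (-(s i • dGamma h))) *
                (exp (s i • dGamma h) * annihilation (orb (f i) 1) * exp (-(s i • dGamma h))) -
              ν 1 • (1 : Matrix (Finset (Orb Λ)) (Finset (Orb Λ)) ℂ))).prod) =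
      (propMatrix β h (hubbardWordOrb (orb x σ) f) (hubbardWordOrb (orb y σ') f) (hubbardWordTime s) -
        Matrix.diagonal (Fin.cons 0 fun m : Fin (k * 2) => ν (finProdFinEquiv.symm m).2)).det := by
  have key := gibbsState_dGamma_prod_evolved_sub_smul_eq_det hh β (hubbardWordOrb (orb x σ) f)
    (hubbardWordOrb (orb y σ') f) (hubbardWordTime s) (Fin.cons 0 fun m : Fin (k * 2) => ν (finProdFinEquiv.symm m).2)
  rw [List.ofFn_succ, List.prod_cons] at key
  simp only [hubbardWordOrb_zero, hubbardWordTime_zero, hubbardWordOrb_succ, hubbardWordTime_succ, Fin.cons_zero,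
    Fin.cons_succ, zero_smul, neg_zero, exp_zero, Matrix.one_mul, Matrix.mul_one, sub_zero] at key
  rw [prod_ofFn_mul_two] at key
  simp only [Equiv.symm_apply_apply] at key
  exact key

variable (G : SimpleGraph Λ) [DecidableRel G.Adj]

/-- **The shifted perturbation series of the Hubbard two-point function in determinant form.** On any finite graph,
for real `β, t, U, μ`, complex shifts `ν₀, ν₁`, orbitals `(x,σ), (y,σ')`, with `h = hubbardOneBody G t μ`, `Z₀ = Tr e^{−βdΓ(h)}`:
`Tr(e^{−β(dΓ(h) + U Σ_z (n_{z↑} − ν₀)(n_{z↓} − ν₁))} c†_{xσ}c_{yσ'}) = Σ_k U^k (−β)^k ∫_{0≤u₀≤⋯≤u_{k−1}≤1} Σ_{x⃗ ∈ Λ^k}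
  Z₀ det (G_{2k+1}(x⃗, u) − D) du`, `D = diagonal (0, ν_{j(m)})`; entire in `U` in finite volume.
[cite: BenfattoGiulianiMastropietro2006, §2.1 (2.8)] -/
theorem hasSum_shiftedHubbard_twoPoint_det (β t U μ : ℝ) (ν : Fin 2 → ℂ) (x y : Λ) (σ σ' : Fin 2) :
    HasSum (fun k : ℕ => (U : ℂ) ^ k * orderedIntegral k (fun u : Fin k → ℝ =>
        (-(β : ℂ)) ^ k * ∑ f : Fin k → Λ, Matrix.partitionFn β (dGamma (hubbardOneBody G t μ)) *
          (propMatrix β (hubbardOneBody G t μ) (hubbardWordOrb (orb x σ) f) (hubbardWordOrb (orb y σ') f)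
              (hubbardWordTime fun i : Fin k => ((u i : ℝ) : ℂ) * -(β : ℂ)) -
            Matrix.diagonal (Fin.cons 0 fun m : Fin (k * 2) => ν (finProdFinEquiv.symm m).2)).det) 1)
      ((Matrix.gibbsWeight β (dGamma (hubbardOneBody G t μ) + (U : ℂ) • ∑ z : Λ,
          ((numberOp z 0 - ν 0 • 1) * (numberOp z 1 - ν 1 • 1))) *
        (creation (orb x σ) * annihilation (orb y σ'))).trace) := by
  haveI : Nonempty (Finset (Orb Λ)) := ⟨∅⟩
  have hZ : Matrix.partitionFn β (dGamma (hubbardOneBody G t μ)) ≠ 0 :=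
    (Matrix.partitionFn_pos β (isHermitian_dGamma (isHermitian_hubbardOneBody G t μ))).ne'
  have hs := hasSum_dyson_trace_mul_shiftedQuartic β (hubbardOneBody G t μ)
    (creation (orb x σ) * annihilation (orb y σ')) (fun _ : Λ => (1 : ℂ))
    (fun z => orb z 0) (fun z => orb z 0) (fun z => orb z 1) (fun z => orb z 1)
    (fun _ => ν 0) (fun _ => ν 1) (U : ℂ)
  simp only [Finset.prod_const_one, one_mul, one_smul] at hs
  simp only [numberOp]
  refine hs.congr_fun fun k => ?_
  refine congrArg (fun F => (U : ℂ) ^ k * orderedIntegral k F 1) (funext fun u => ?_)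
  refine congrArg (fun S => (-(β : ℂ)) ^ k * S) (Finset.sum_congr rfl fun f _ => ?_)
  rw [← gibbsState_dGamma_twoPoint_mul_prod_shiftedHubbardVertex_eq_det (isHermitian_hubbardOneBody G t μ) β x y σ σ'
    f (fun i : Fin k => ((u i : ℝ) : ℂ) * -(β : ℂ)) ν, Matrix.gibbsState_apply, mul_inv_cancel_left₀ hZ]

/-- **The renormalised perturbation series of the Hubbard two-point function (finite volume, determinant form).**
For real `β, t, U, μ, ν`, with the FREE one-body matrix at chemical potential `μ` and the INTERACTING model at `μ + Uν`:
`Σ_k U^k (−β)^k ∫_{0≤u₀≤⋯≤u_{k−1}≤1} Σ_{x⃗ ∈ Λ^k} Z₀ det (G_{2k+1}(x⃗, u) − diag(0, ν, …, ν)) du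
  = e^{−βUν²|Λ|} · Tr(e^{−β(H(t,U) − (μ+Uν)N)} c†_{xσ} c_{yσ'})` — the expansion of the equal-time two-point function at
fixed free Fermi surface with the counterterm `ν` on the diagonal of the vertex pairs (the observable pair unshifted).
BGM 2006 §2. [cite: BenfattoGiulianiMastropietro2006, §2.1 (2.8)] -/
theorem hasSum_hubbard_twoPoint_renormalised_det (β t U μ ν : ℝ) (x y : Λ) (σ σ' : Fin 2) :
    HasSum (fun k : ℕ => (U : ℂ) ^ k * orderedIntegral k (fun u : Fin k → ℝ =>
        (-(β : ℂ)) ^ k * ∑ f : Fin k → Λ, Matrix.partitionFn β (dGamma (hubbardOneBody G t μ)) *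
          (propMatrix β (hubbardOneBody G t μ) (hubbardWordOrb (orb x σ) f) (hubbardWordOrb (orb y σ') f)
              (hubbardWordTime fun i : Fin k => ((u i : ℝ) : ℂ) * -(β : ℂ)) -
            Matrix.diagonal (Fin.cons 0 fun _ : Fin (k * 2) => (ν : ℂ))).det) 1)
      ((Real.exp (-(β * (U * ν ^ 2 * Fintype.card Λ))) : ℂ) *
        (Matrix.gibbsWeight β (hamiltonianWith G t U (μ + U * ν)) * (creation (orb x σ) * annihilation (orb y σ'))).trace) := by
  have hs := hasSum_shiftedHubbard_twoPoint_det G β t U μ (fun _ => (ν : ℂ)) x y σ σ'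
  beta_reduce at hs
  rw [dGamma_hubbardOneBody_add_smul_sum_shiftedVertex, gibbsWeight_add_smul_one, Matrix.smul_mul, Matrix.trace_smul,
    smul_eq_mul] at hs
  have hexp : Complex.exp (-(β : ℂ) * ((U * ν ^ 2 * Fintype.card Λ : ℝ) : ℂ)) =
      ((Real.exp (-(β * (U * ν ^ 2 * Fintype.card Λ))) : ℝ) : ℂ) := by
    rw [Complex.ofReal_exp]
    push_cast
    ring_nf
  rw [hexp] at hs
  exact hs

end ShiftedHubbard

end Literature.MathematicalPhysics.QuantumLattice
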